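import Summits.FinalStateConjecture.FinalStateConjecture.Theorems.SwallowTheDatumKerrShieldedSettlesStubKerrVacuumAux6
import Summits.FinalStateConjecture.FinalStateConjecture.Theorems.SwallowTheDatumKerrShieldedSettlesStubKerrVacuumAux7
import HarnessLib

/-!
# Kerr is Ricci-flat, algebra XII: `Ξ_{32}`, `Ξ_{33}` and the quadratic Christoffel terms `T_{kl}`

Support file for the stub `stub_kerrVacuum` of line `tapered-temporal-collar` (crux
`stmt-FinalStateConjecture-10054`): the Kerr metric `g_{M,a} = η + 2H ℓ ⊗ ℓ` in ingoing
Kerr–Schild Cartesian coordinates is Ricci-flat for all real `M, a, r₀` (`Kerr.isRicciFlat`).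
The pure algebra is done over six real variables `(a, M, x₁, x₂, r, c)`: at a point of the chart
with Kerr–Schild radius `r > 0` put `c = z/r` (`= cos θ`), so that the defining quartic of `r`
reads `x₂² = (r² + a²)(1 − c²) − x₁²`, and `Σ = r² + a²c²`, `H = M r/Σ`,
`ℓ = (1, (r x₁ + a x₂)/(r² + a²), (r x₂ − a x₁)/(r² + a²), c)`.
Closed forms of `Ξ_{kl}` (concluded); `∑_i ℓ^i K(∂_i,∂_l,∂_m) = ℓ♯(f) ℓ_l ℓ_m` and `ℓ` null; the
reduction `t4_flat` of `T_{kl} = ∑ Γ^m_{il} Γ^i_{km}` to its flat part (the cross terms vanish); the flat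
quadratic Koszul terms and `T_{kl}` in closed form. Kerr–Schild 1965, §3.

## References

* R. P. Kerr, *Gravitational field of a spinning mass as an example of algebraically special
  metrics*, Phys. Rev. Lett. 11 (1963) 237–238.
* R. P. Kerr, A. Schild, *A new class of vacuum solutions of the Einstein field equations*
  (1965), §§2–3.
* M. Visser, *The Kerr spacetime: a brief introduction*, arXiv:0706.0622, (32)–(36).
* B. O'Neill, *The geometry of Kerr black holes* (1995), Ch. 2, Thm. 2.6.1.
-/

-- buildfix B11-4: elaborate the proofs of this file SEQUENTIALLY — several multi-million-node `field_simp/ring_nf`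
-- certificates elaborating in parallel made lean abort (farm node-rc=250) on the plain build path; one at a time they fit.
set_option Elab.async false
set_option linter.dupNamespace false
set_option linter.unusedSimpArgs false
set_option linter.unusedTactic false
set_option linter.unreachableTactic false
set_option linter.unnecessarySeqFocus false

noncomputable section

namespace Summit.FinalStateConjecture.FinalStateConjecture.Theorems.SwallowTheDatum.KerrShieldedSettles

namespace StubKerrVacuum

set_option maxRecDepth 8192 in
set_option maxHeartbeats 8000000 in
/-- `Ξ_{32} = ∑_{iβ} g^{iβ} ∂_i∂_β g_{32}` in closed form. [cite: KerrSchild1965, §3] -/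
theorem xiT_eq_32 (a M x₁ x₂ r c : ℝ) (_hr : r ≠ 0) (_hS : r^2 + a^2*c^2 ≠ 0) (_hP : r^2 + a^2 ≠ 0)
    (_hC : x₂^2 = (r^2 + a^2)*(1 - c^2) - x₁^2) :
    ∑ i : Fin 4, ∑ β : Fin 4,
        ginvT a M x₁ x₂ r c i β * d2gT a M x₁ x₂ r c i β 3 2 = xiT a M x₁ x₂ r c 3 2 := by
  simp only [xiT]
  simp only [Fin.sum_univ_four, hT, ellT, kupT, etaT, sgnT, gT, ginvT, drT, dhT, dl1T,
      dl2T, dl3T, dlT, d2rT, d2hT, d2l1T, d2l2T, d2l3T, d2lT, dgT, kzT, d2gT, kT, kT00, kT01, kT02,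
          kT03,
      kT11, kT12, kT13, kT22, kT23, kT33, fDfT, dfT, gamT, psiT, Fin.isValue, Fin.reduceEq, if_true,
      if_false]
  (field_simp <;> ring_nf <;> (try simp only [xp16 _hC, xp15 _hC, xp14 _hC, xp13 _hC, xp12 _hC,
      xp11 _hC,
      xp10 _hC, xp9 _hC, xp8 _hC, xp7 _hC, xp6 _hC, xp5 _hC, xp4 _hC, xp3 _hC,
          _hC]) <;> (try ring_nf))

set_option maxRecDepth 8192 in
set_option maxHeartbeats 8000000 in
/-- `Ξ_{33} = ∑_{iβ} g^{iβ} ∂_i∂_β g_{33}` in closed form. [cite: KerrSchild1965, §3] -/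
theorem xiT_eq_33 (a M x₁ x₂ r c : ℝ) (_hr : r ≠ 0) (_hS : r^2 + a^2*c^2 ≠ 0) (_hP : r^2 + a^2 ≠ 0)
    (_hC : x₂^2 = (r^2 + a^2)*(1 - c^2) - x₁^2) :
    ∑ i : Fin 4, ∑ β : Fin 4,
        ginvT a M x₁ x₂ r c i β * d2gT a M x₁ x₂ r c i β 3 3 = xiT a M x₁ x₂ r c 3 3 := by
  simp only [xiT]
  simp only [Fin.sum_univ_four, hT, ellT, kupT, etaT, sgnT, gT, ginvT, drT, dhT, dl1T,
      dl2T, dl3T, dlT, d2rT, d2hT, d2l1T, d2l2T, d2l3T, d2lT, dgT, kzT, d2gT, kT, kT00, kT01, kT02,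
          kT03,
      kT11, kT12, kT13, kT22, kT23, kT33, fDfT, dfT, gamT, psiT, Fin.isValue, Fin.reduceEq, if_true,
      if_false]
  (field_simp <;> ring_nf <;> (try simp only [xp16 _hC, xp15 _hC, xp14 _hC, xp13 _hC, xp12 _hC,
      xp11 _hC,
      xp10 _hC, xp9 _hC, xp8 _hC, xp7 _hC, xp6 _hC, xp5 _hC, xp4 _hC, xp3 _hC,
          _hC]) <;> (try ring_nf))

set_option maxRecDepth 8192 in
set_option maxHeartbeats 4000000 in
/-- `∑_i ℓ^i K(∂_i, ∂_l, ∂_m) = ℓ♯(f) ℓ_l ℓ_m` (`ℓ` null and geodesic: `ℓ^i ∂_l h_{im} = 0`,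
`ℓ^i ∂_i h_{lm} = ℓ♯(f) ℓ_l ℓ_m`). [cite: KerrSchild1965, §2] -/
theorem lamT_eq (a M x₁ x₂ r c : ℝ) (_hr : r ≠ 0) (_hS : r^2 + a^2*c^2 ≠ 0) (_hP : r^2 + a^2 ≠ 0)
    (_hC : x₂^2 = (r^2 + a^2)*(1 - c^2) - x₁^2) (l m : Fin 4) :
    ∑ i : Fin 4,
        kupT a M x₁ x₂ r c i * kT a M x₁ x₂ r c i l m = dfT a M x₁ x₂ r c * ellT a M x₁ x₂ r c l
        * ellT a M x₁ x₂ r c m := by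
  fin_cases l <;> fin_cases m <;>
    simp only [Fin.sum_univ_four, hT, ellT, kupT, etaT, sgnT, gT, ginvT, drT, dhT, dl1T,
      dl2T, dl3T, dlT, d2rT, d2hT, d2l1T, d2l2T, d2l3T, d2lT, dgT, kzT, d2gT, kT, kT00, kT01, kT02,
          kT03,
      kT11, kT12, kT13, kT22, kT23, kT33, fDfT, dfT, gamT, psiT, Fin.isValue, Fin.reduceEq, if_true,
      if_false] <;>
    (field_simp <;> ring_nf <;> (try simp only [xp16 _hC, xp15 _hC, xp14 _hC, xp13 _hC, xp12 _hC,
        xp11 _hC,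
      xp10 _hC, xp9 _hC, xp8 _hC, xp7 _hC, xp6 _hC, xp5 _hC, xp4 _hC, xp3 _hC,
          _hC]) <;> (try ring_nf))

set_option maxRecDepth 8192 in
set_option maxHeartbeats 4000000 in
/-- `∑_m ℓ^m K(∂_k, ∂_m, ∂_i) = ℓ♯(f) ℓ_k ℓ_i` (the same contraction on the second slot).
[cite: KerrSchild1965, §2] -/
theorem lamT_eq' (a M x₁ x₂ r c : ℝ) (_hr : r ≠ 0) (_hS : r^2 + a^2*c^2 ≠ 0) (_hP : r^2 + a^2 ≠ 0)
    (_hC : x₂^2 = (r^2 + a^2)*(1 - c^2) - x₁^2) (k i : Fin 4) :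
    ∑ m : Fin 4,
        kupT a M x₁ x₂ r c m * kT a M x₁ x₂ r c k m i = dfT a M x₁ x₂ r c * ellT a M x₁ x₂ r c k
        * ellT a M x₁ x₂ r c i := by
  fin_cases k <;> fin_cases i <;>
    simp only [Fin.sum_univ_four, hT, ellT, kupT, etaT, sgnT, gT, ginvT, drT, dhT, dl1T,
      dl2T, dl3T, dlT, d2rT, d2hT, d2l1T, d2l2T, d2l3T, d2lT, dgT, kzT, d2gT, kT, kT00, kT01, kT02,
          kT03,
      kT11, kT12, kT13, kT22, kT23, kT33, fDfT, dfT, gamT, psiT, Fin.isValue, Fin.reduceEq, if_true,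
      if_false] <;>
    (field_simp <;> ring_nf <;> (try simp only [xp16 _hC, xp15 _hC, xp14 _hC, xp13 _hC, xp12 _hC,
        xp11 _hC,
      xp10 _hC, xp9 _hC, xp8 _hC, xp7 _hC, xp6 _hC, xp5 _hC, xp4 _hC, xp3 _hC,
          _hC]) <;> (try ring_nf))

/-- `ℓ` is null: `∑ ℓ^i ℓ_i = 0` (the quartic of `r`). [cite: KerrSchild1965, §2] -/
theorem nullT (a M x₁ x₂ r c : ℝ) (_hr : r ≠ 0) (_hS : r^2 + a^2*c^2 ≠ 0) (_hP : r^2 + a^2 ≠ 0)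
    (_hC : x₂^2 = (r^2 + a^2)*(1 - c^2) - x₁^2) :
    ∑ i : Fin 4, kupT a M x₁ x₂ r c i * ellT a M x₁ x₂ r c i = 0 := by
  simp only [Fin.sum_univ_four, hT, ellT, kupT, etaT, sgnT, gT, ginvT, drT, dhT, dl1T,
      dl2T, dl3T, dlT, d2rT, d2hT, d2l1T, d2l2T, d2l3T, d2lT, dgT, kzT, d2gT, kT, kT00, kT01, kT02,
          kT03,
      kT11, kT12, kT13, kT22, kT23, kT33, fDfT, dfT, gamT, psiT, Fin.isValue, Fin.reduceEq, if_true,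
      if_false]
  (field_simp <;> ring_nf <;> (try simp only [xp16 _hC, xp15 _hC, xp14 _hC, xp13 _hC, xp12 _hC,
      xp11 _hC,
      xp10 _hC, xp9 _hC, xp8 _hC, xp7 _hC, xp6 _hC, xp5 _hC, xp4 _hC, xp3 _hC,
          _hC]) <;> (try ring_nf))

/-- **The quadratic Christoffel term reduces to its flat part**: with
`Γ^α_{μν} = ½ η^{αα} K(∂_μ,∂_ν,∂_α) + ½fℓ♯(f) ℓ^αℓ_μℓ_ν` the cross terms of `∑ Γ^m_{il}Γ^i_{km}`
vanish by `lamT_eq`, `lamT_eq'` and `ℓ` null, leaving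
`∑_{m,i} ¼ η^{mm}η^{ii} K(∂_i,∂_l,∂_m) K(∂_k,∂_m,∂_i)`.
[cite: KerrSchild1965, §3] -/
theorem t4_flat (a M x₁ x₂ r c : ℝ) (_hr : r ≠ 0) (_hS : r^2 + a^2*c^2 ≠ 0) (_hP : r^2 + a^2 ≠ 0)
    (_hC : x₂^2 = (r^2 + a^2)*(1 - c^2) - x₁^2) (k l : Fin 4) :
    ∑ i : Fin 4, ∑ m : Fin 4, gamT a M x₁ x₂ r c m i l * gamT a M x₁ x₂ r c i k m =
      ∑ m : Fin 4, ∑ i : Fin 4, sgnT m * sgnT i / 4 *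
        kT a M x₁ x₂ r c i l m * kT a M x₁ x₂ r c k m i := by
  have hL := lamT_eq a M x₁ x₂ r c _hr _hS _hP _hC l
  have hL' := lamT_eq' a M x₁ x₂ r c _hr _hS _hP _hC k
  have hN := nullT a M x₁ x₂ r c _hr _hS _hP _hC
  simp only [Fin.sum_univ_four, Fin.isValue] at hL hL' hN
  simp only [Fin.sum_univ_four, gamT, Fin.isValue]
  linear_combination (norm := skip)
    (fDfT a M x₁ x₂ r c * ellT a M x₁ x₂ r c k / 2 * kupT a M x₁ x₂ r c 0) * hL 0 +
    (fDfT a M x₁ x₂ r c * ellT a M x₁ x₂ r c k / 2 * kupT a M x₁ x₂ r c 1) * hL 1 +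
    (fDfT a M x₁ x₂ r c * ellT a M x₁ x₂ r c k / 2 * kupT a M x₁ x₂ r c 2) * hL 2 +
    (fDfT a M x₁ x₂ r c * ellT a M x₁ x₂ r c k / 2 * kupT a M x₁ x₂ r c 3) * hL 3 +
    (fDfT a M x₁ x₂ r c * ellT a M x₁ x₂ r c l / 2 * kupT a M x₁ x₂ r c 0) * hL' 0 +
    (fDfT a M x₁ x₂ r c * ellT a M x₁ x₂ r c l / 2 * kupT a M x₁ x₂ r c 1) * hL' 1 +
    (fDfT a M x₁ x₂ r c * ellT a M x₁ x₂ r c l / 2 * kupT a M x₁ x₂ r c 2) * hL' 2 +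
    (fDfT a M x₁ x₂ r c * ellT a M x₁ x₂ r c l / 2 * kupT a M x₁ x₂ r c 3) * hL' 3 +
    (fDfT a M x₁ x₂ r c * dfT a M x₁ x₂ r c * ellT a M x₁ x₂ r c k * ellT a M x₁ x₂ r c l +
      fDfT a M x₁ x₂ r c ^ 2 * ellT a M x₁ x₂ r c k * ellT a M x₁ x₂ r c l *
        (kupT a M x₁ x₂ r c 0 * ellT a M x₁ x₂ r c 0 + kupT a M x₁ x₂ r c 1 * ellT a M x₁ x₂ r c 1 +
          kupT a M x₁ x₂ r c 2 * ellT a M x₁ x₂ r c 2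
              + kupT a M x₁ x₂ r c 3 * ellT a M x₁ x₂ r c 3)) * hN
  simp only [sgnT, kupT, ellT, Fin.isValue]
  ring1

set_option maxRecDepth 8192 in
set_option maxHeartbeats 8000000 in
/-- The flat quadratic Koszul terms `¼ η^{mm} ∑_i η^{ii} K(∂_i,∂_l,∂_m) K(∂_0,∂_m,∂_i)` in
closed form. [cite: KerrSchild1965, §3] -/
theorem aaT_eq_0 (a M x₁ x₂ r c : ℝ) (_hr : r ≠ 0) (_hS : r^2 + a^2*c^2 ≠ 0) (_hP : r^2 + a^2 ≠ 0)
    (_hC : x₂^2 = (r^2 + a^2)*(1 - c^2) - x₁^2) (l m : Fin 4) :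
    ∑ i : Fin 4, sgnT m * sgnT i / 4 *
        kT a M x₁ x₂ r c i l m * kT a M x₁ x₂ r c 0 m i = aaT a M x₁ x₂ r c 0 l m := by
  fin_cases l <;> fin_cases m <;> simp only [aaT, aaT0] <;>
    simp only [Fin.sum_univ_four, hT, ellT, kupT, etaT, sgnT, gT, ginvT, drT, dhT, dl1T,
      dl2T, dl3T, dlT, d2rT, d2hT, d2l1T, d2l2T, d2l3T, d2lT, dgT, kzT, d2gT, kT, kT00, kT01, kT02,
          kT03,
      kT11, kT12, kT13, kT22, kT23, kT33, fDfT, dfT, gamT, psiT, Fin.isValue, Fin.reduceEq, if_true,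
      if_false] <;>
    (field_simp <;> ring_nf <;> (try simp only [xp16 _hC, xp15 _hC, xp14 _hC, xp13 _hC, xp12 _hC,
        xp11 _hC,
      xp10 _hC, xp9 _hC, xp8 _hC, xp7 _hC, xp6 _hC, xp5 _hC, xp4 _hC, xp3 _hC,
          _hC]) <;> (try ring_nf))

set_option maxRecDepth 8192 in
set_option maxHeartbeats 8000000 in
/-- The flat quadratic Koszul terms `¼ η^{mm} ∑_i η^{ii} K(∂_i,∂_l,∂_m) K(∂_1,∂_m,∂_i)` in
closed form. [cite: KerrSchild1965, §3] -/
theorem aaT_eq_1 (a M x₁ x₂ r c : ℝ) (_hr : r ≠ 0) (_hS : r^2 + a^2*c^2 ≠ 0) (_hP : r^2 + a^2 ≠ 0)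
    (_hC : x₂^2 = (r^2 + a^2)*(1 - c^2) - x₁^2) (l m : Fin 4) :
    ∑ i : Fin 4, sgnT m * sgnT i / 4 *
        kT a M x₁ x₂ r c i l m * kT a M x₁ x₂ r c 1 m i = aaT a M x₁ x₂ r c 1 l m := by
  fin_cases l <;> fin_cases m <;> simp only [aaT, aaT1] <;>
    simp only [Fin.sum_univ_four, hT, ellT, kupT, etaT, sgnT, gT, ginvT, drT, dhT, dl1T,
      dl2T, dl3T, dlT, d2rT, d2hT, d2l1T, d2l2T, d2l3T, d2lT, dgT, kzT, d2gT, kT, kT00, kT01, kT02,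
          kT03,
      kT11, kT12, kT13, kT22, kT23, kT33, fDfT, dfT, gamT, psiT, Fin.isValue, Fin.reduceEq, if_true,
      if_false] <;>
    (field_simp <;> ring_nf <;> (try simp only [xp16 _hC, xp15 _hC, xp14 _hC, xp13 _hC, xp12 _hC,
        xp11 _hC,
      xp10 _hC, xp9 _hC, xp8 _hC, xp7 _hC, xp6 _hC, xp5 _hC, xp4 _hC, xp3 _hC,
          _hC]) <;> (try ring_nf))

set_option maxRecDepth 8192 in
set_option maxHeartbeats 8000000 in
/-- The flat quadratic Koszul terms `¼ η^{mm} ∑_i η^{ii} K(∂_i,∂_l,∂_m) K(∂_2,∂_m,∂_i)` in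
closed form. [cite: KerrSchild1965, §3] -/
theorem aaT_eq_2 (a M x₁ x₂ r c : ℝ) (_hr : r ≠ 0) (_hS : r^2 + a^2*c^2 ≠ 0) (_hP : r^2 + a^2 ≠ 0)
    (_hC : x₂^2 = (r^2 + a^2)*(1 - c^2) - x₁^2) (l m : Fin 4) :
    ∑ i : Fin 4, sgnT m * sgnT i / 4 *
        kT a M x₁ x₂ r c i l m * kT a M x₁ x₂ r c 2 m i = aaT a M x₁ x₂ r c 2 l m := by
  fin_cases l <;> fin_cases m <;> simp only [aaT, aaT2] <;>
    simp only [Fin.sum_univ_four, hT, ellT, kupT, etaT, sgnT, gT, ginvT, drT, dhT, dl1T,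
      dl2T, dl3T, dlT, d2rT, d2hT, d2l1T, d2l2T, d2l3T, d2lT, dgT, kzT, d2gT, kT, kT00, kT01, kT02,
          kT03,
      kT11, kT12, kT13, kT22, kT23, kT33, fDfT, dfT, gamT, psiT, Fin.isValue, Fin.reduceEq, if_true,
      if_false] <;>
    (field_simp <;> ring_nf <;> (try simp only [xp16 _hC, xp15 _hC, xp14 _hC, xp13 _hC, xp12 _hC,
        xp11 _hC,
      xp10 _hC, xp9 _hC, xp8 _hC, xp7 _hC, xp6 _hC, xp5 _hC, xp4 _hC, xp3 _hC,
          _hC]) <;> (try ring_nf))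

set_option maxRecDepth 8192 in
set_option maxHeartbeats 8000000 in
/-- The flat quadratic Koszul terms `¼ η^{mm} ∑_i η^{ii} K(∂_i,∂_l,∂_m) K(∂_3,∂_m,∂_i)` in
closed form. [cite: KerrSchild1965, §3] -/
theorem aaT_eq_3 (a M x₁ x₂ r c : ℝ) (_hr : r ≠ 0) (_hS : r^2 + a^2*c^2 ≠ 0) (_hP : r^2 + a^2 ≠ 0)
    (_hC : x₂^2 = (r^2 + a^2)*(1 - c^2) - x₁^2) (l m : Fin 4) :
    ∑ i : Fin 4, sgnT m * sgnT i / 4 *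
        kT a M x₁ x₂ r c i l m * kT a M x₁ x₂ r c 3 m i = aaT a M x₁ x₂ r c 3 l m := by
  fin_cases l <;> fin_cases m <;> simp only [aaT, aaT3] <;>
    simp only [Fin.sum_univ_four, hT, ellT, kupT, etaT, sgnT, gT, ginvT, drT, dhT, dl1T,
      dl2T, dl3T, dlT, d2rT, d2hT, d2l1T, d2l2T, d2l3T, d2lT, dgT, kzT, d2gT, kT, kT00, kT01, kT02,
          kT03,
      kT11, kT12, kT13, kT22, kT23, kT33, fDfT, dfT, gamT, psiT, Fin.isValue, Fin.reduceEq, if_true,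
      if_false] <;>
    (field_simp <;> ring_nf <;> (try simp only [xp16 _hC, xp15 _hC, xp14 _hC, xp13 _hC, xp12 _hC,
        xp11 _hC,
      xp10 _hC, xp9 _hC, xp8 _hC, xp7 _hC, xp6 _hC, xp5 _hC, xp4 _hC, xp3 _hC,
          _hC]) <;> (try ring_nf))

/-- The flat quadratic Koszul terms in closed form, all indices. [cite: KerrSchild1965, §3] -/
theorem aaT_eq (a M x₁ x₂ r c : ℝ) (_hr : r ≠ 0) (_hS : r^2 + a^2*c^2 ≠ 0) (_hP : r^2 + a^2 ≠ 0)
    (_hC : x₂^2 = (r^2 + a^2)*(1 - c^2) - x₁^2) (k l m : Fin 4) :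
    ∑ i : Fin 4, sgnT m * sgnT i / 4 *
        kT a M x₁ x₂ r c i l m * kT a M x₁ x₂ r c k m i = aaT a M x₁ x₂ r c k l m := by
  fin_cases k
  exacts [aaT_eq_0 a M x₁ x₂ r c _hr _hS _hP _hC l m, aaT_eq_1 a M x₁ x₂ r c _hr _hS _hP _hC l m,
      aaT_eq_2 a M x₁ x₂ r c _hr _hS _hP _hC l m, aaT_eq_3 a M x₁ x₂ r c _hr _hS _hP _hC l m]

set_option maxRecDepth 8192 in
set_option maxHeartbeats 4000000 in
/-- **`T_{kl} = ∑_{i,m} Γ^m_{il} Γ^i_{km}` of the Kerr metric in closed form.**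
[cite: KerrSchild1965, §3] -/
theorem t4T_eq (a M x₁ x₂ r c : ℝ) (_hr : r ≠ 0) (_hS : r^2 + a^2*c^2 ≠ 0) (_hP : r^2 + a^2 ≠ 0)
    (_hC : x₂^2 = (r^2 + a^2)*(1 - c^2) - x₁^2) (k l : Fin 4) :
    ∑ i : Fin 4, ∑ m : Fin 4,
        gamT a M x₁ x₂ r c m i l * gamT a M x₁ x₂ r c i k m = t4T a M x₁ x₂ r c k l := by
  rw [t4_flat a M x₁ x₂ r c _hr _hS _hP _hC k l]
  simp only [aaT_eq a M x₁ x₂ r c _hr _hS _hP _hC k l]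
  fin_cases k <;> fin_cases l <;>
    simp only [Fin.sum_univ_four, aaT, aaT0, aaT1, aaT2, aaT3, t4T, Fin.isValue] <;>
    (field_simp <;> ring_nf <;> (try simp only [xp16 _hC, xp15 _hC, xp14 _hC, xp13 _hC, xp12 _hC,
        xp11 _hC,
      xp10 _hC, xp9 _hC, xp8 _hC, xp7 _hC, xp6 _hC, xp5 _hC, xp4 _hC, xp3 _hC,
          _hC]) <;> (try ring_nf))

end StubKerrVacuum

/-- **Registered sub-goal `stub_kerrVacuumT4`** of stub `stub_kerrVacuum` (line
`tapered-temporal-collar`): the quadratic Christoffel terms `T_{kl} = ∑ Γ^m_{il} Γ^i_{km}` in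
closed form (flat reduction, `ℓ` null geodesic).
[cite: KerrSchild1965, §3] -/
theorem stub_kerrVacuumT4 : ∀ (a M x₁ x₂ r c : ℝ),
    r ≠ 0 → r ^ 2 + a ^ 2 * c ^ 2 ≠ 0 → r ^ 2 + a ^ 2 ≠ 0 → x₂ ^ 2 = (r ^ 2
    + a ^ 2) * (1 - c ^ 2) - x₁ ^ 2 → ∀ (k l : Fin 4), ∑ i : Fin 4, ∑ m : Fin 4,
    StubKerrVacuum.gamT a M x₁ x₂ r c m i l
    * StubKerrVacuum.gamT a M x₁ x₂ r c i k m = StubKerrVacuum.t4T a M x₁ x₂ r c k l :=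
  fun a M x₁ x₂ r c hr hS hP hC k l ↦ StubKerrVacuum.t4T_eq a M x₁ x₂ r c hr hS hP hC k l

end Summit.FinalStateConjecture.FinalStateConjecture.Theorems.SwallowTheDatum.KerrShieldedSettles
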